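import Literature.Topology.FourManifolds.SurgeryGluck
import Literature.Topology.FourManifolds.SliceGenus
import Literature.Topology.FourManifolds.SmoothOrientationSphereProofs
import Literature.AlgebraicTopology.SingularHomology.ExcisionMayerVietoris
import Literature.AlgebraicTopology.SingularHomology.ExcisionMayerVietorisProofs
import Mathlib.Analysis.Normed.Module.Connected
import HarnessLib

/-!
# Property R (Gabai 1987): the printed proof architecture of `isUnknot_of_isIntegralSurgery_zero`

Sibling file of `SurgeryGluck.lean` (statement `spc4.S25`, the named fact
`Literature.Topology.FourManifolds.isUnknot_of_isIntegralSurgery_zero`: if `0`-surgery on a knot `K ⊆ S³` is `S² × S¹`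
then `K` is the unknot). That fact is the **Property R theorem** of D. Gabai, *Foliations and the
topology of 3-manifolds III*, J. Differential Geom. 26 (1987) 479–536: Corollary 8.3 with
Remark 8.5 (p. 526: "The Property R conjecture asserts that zero frame surgery on a nontrivial knot
`k` in `S³` does not yield `S² × S¹`. … Corollary 8.3 gives positive proofs of these conjectures.").
Its proof is a theory (sutured manifold hierarchies and taut finite depth foliations, Gabai I–III;
or Scharlemann's foliation-free variant, Remarks 8.3½), none of whose ingredients — Seifert
surfaces, incompressible surfaces, irreducibility, the Thurston norm, foliations, the theorems of
Novikov, Reeb and Alexander, isotopy extension — exists in Mathlib or in `Literature/`, so no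
`isUnknot_of_isIntegralSurgery_zero_holds` is vendored. This file records instead, sorry-free, the
printed argument: its one deep ingredient as a named fact stated as printed, and everything
downstream of it proved.

* `Literature.HasNonseparatingSurfaceOfGenus IM M g` (**definition**): the manifold `M` contains a
  nonseparating closed connected orientable smoothly embedded surface of genus `g` — the notion
  quantified over in Gabai's Corollary 8.3 (and in the definition of the Thurston norm).
* `Literature.Topology.FourManifolds.Knot.hasSeifertSurfaceOfGenus_le_of_isIntegralSurgery_zero` (**named fact**, Gabai's
  Corollary 8.3, p. 525: "If `M` is obtained by performing zero frame surgery on a knot in `S³`,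
  then `M` is prime and genus `k = min{genus S | S` is a nonseparating oriented embedded surface in
  `M}`"; vendored: the half `genus k ≤ genus S` of the equality, for every `0`-surgery `M` on `K`
  and every such surface `S ⊆ M`).
* `Literature.Topology.FourManifolds.hasNonseparatingSurfaceOfGenus_zero_sphereTwo_prod` (**proved**, given the classical named
  fact `H₁(S²; ℤ) = 0`, `Literature.AlgebraicTopology.SingularHomology.isZero_singularHomology_sphere`, Hatcher Cor. 2.14): the sphere
  `S² × {p}` is a nonseparating surface of genus `0` in `S² × S¹` — the observation of Remark 8.5.
* `Literature.Topology.FourManifolds.Knot.hasSeifertSurfaceOfGenus_zero_of_isIntegralSurgery_zero`,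
  `Literature.Topology.FourManifolds.Knot.genus_eq_zero_of_isIntegralSurgery_zero` (**proved** from the two): if `S² × S¹` is
  `0`-surgery on `K`, then `K` bounds an embedded disc, so `K.genus = 0`.
* `Literature.Topology.FourManifolds.isUnknot_of_isIntegralSurgery_zero_of_genus` (**proved**): together with "genus `0`
  iff unknot" (`Literature.Topology.FourManifolds.Knot.genus_eq_zero_iff_isUnknot`, named fact of `SliceGenus.lean`,
  Papakyriakopoulos 1957 / Rolfsen §4.B, §5.A) this gives `isUnknot_of_isIntegralSurgery_zero` —
  exactly the deduction of Gabai's Remark 8.5.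

So `isUnknot_of_isIntegralSurgery_zero` is reduced, with proof, to three named facts: Gabai's
Corollary 8.3 (genus clause), `H₁(S²; ℤ) = 0`, and "genus `0` ⇒ unknot" (Dehn's lemma).

**Update.** The second of these is now a theorem,
`Literature.AlgebraicTopology.SingularHomology.isZero_singularHomology_sphere_holds` (`ExcisionMayerVietorisProofs.lean`, Hatcher Cor. 2.14
proved by Mayer–Vietoris), so the final section of this file records the reduction free of it:
`Literature.Topology.FourManifolds.HasNonseparatingSurfaceOfGenus.sphereTwo_prod_sphereOne` (`S² × {p} ⊆ S² × S¹` is a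
nonseparating sphere, unconditionally) and
`Literature.SPC4.isUnknot_of_isIntegralSurgery_zero_of_gabai (h83) (hD)` — `spc4.S25` from exactly two
named facts, Gabai's Corollary 8.3 (genus clause) and "genus `0` ⇒ unknot".

## References

* D. Gabai, *Foliations and the topology of 3-manifolds. III*, J. Differential Geom. 26 (1987)
  479–536, Thm. 3.1, Def. 8.1, Cor. 8.2, Cor. 8.3, Remarks 8.3½, Remark 8.5 [GabaiJDG1987].
* W. P. Thurston, *A norm for the homology of three-manifolds*, Mem. Amer. Math. Soc. 59 (1986),
  no. 339 (Gabai's [22]).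
* A. Hatcher, *Algebraic Topology* (2002), Cor. 2.14 [HatcherAT2002].
* C. D. Papakyriakopoulos, *On Dehn's lemma and the asphericity of knots*, Ann. of Math. 66
  (1957) [Papakyriakopoulos1957]; D. Rolfsen, *Knots and Links* (1976), §4.B, §5.A, §9.G.

## Design notes

* In `HasNonseparatingSurfaceOfGenus` the surface is *closed* (compact, and boundaryless since it
  is modelled on `𝓡 2`), connected and orientable, its genus is recorded as
  `rank_ℤ H₁(S; ℤ) = 2g` exactly as in `Literature.Topology.FourManifolds.Knot.IsSpanningSurfaceOfGenus` (`SliceGenus.lean`), the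
  embedding is a smooth injective immersion (an embedding, `S` being compact), and
  "nonseparating" is `IsConnected (range F)ᶜ` (connected, in particular nonempty, complement).
  The surface type is quantified in `Type`, where `𝕊 2` and all concrete surfaces live (as in
  `SliceGenus.lean`); the ambient `M` of the Gabai fact is universe polymorphic (`Type u`, as in
  `Literature.Topology.FourManifolds.exists_isIntegralSurgeryLink`), any model with corners, and is assumed `IsManifold`.
* The conclusion of the Gabai fact is `∃ g' ≤ g, K.HasSeifertSurfaceOfGenus g'` ("`k` bounds a
  Seifert surface of genus `≤ genus S`"), which is what "genus `k ≤ genus S`" means in the source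
  (genus `k` is a minimum over Seifert surfaces, which exist), rather than the formally weaker
  `K.genus ≤ g` (`Literature.Topology.FourManifolds.Knot.genus` is an `sInf` over `ℕ` with junk value `0` on the empty set).
  Only the half `≤` of the printed equality is vendored (it is the half used in Remark 8.5); the
  half `≥` (the capped-off minimal genus Seifert surface `Ŝ ⊆ M` of Cor. 8.2 is nonseparating of
  genus = genus `k`) and the primeness of `M` are not.
* The hypothesis `IsIntegralSurgery IM M K 0` is Gabai's "zero frame surgery" (Def. 8.1, p. 524:
  Dehn surgery along the longitude, the curve on `∂N(k)` null-homologous in the knot exterior =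
  framing `0`, `Knot.TubularNbhd.HasFraming`); for `M = ↥(𝕊 2) × ↥(𝕊 1)` with model
  `(𝓡 2).prod (𝓡 1)` it is verbatim the hypothesis of `isUnknot_of_isIntegralSurgery_zero`.
* Notation `𝔼 n`, `𝕊 n` is local, as in the sibling files.
-/

open scoped Manifold ContDiff Topology
open Function Set

noncomputable section

universe u

namespace Literature.Topology.FourManifolds

/-- Local notation: `𝔼 n` is the model Euclidean space `EuclideanSpace ℝ (Fin n)`. -/
local notation "𝔼 " n:arg => EuclideanSpace ℝ (Fin n)

/-- Local notation: `𝕊 n` is the unit sphere in `EuclideanSpace ℝ (Fin (n + 1))`, the standard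
`n`-sphere with its Mathlib manifold structure. -/
local notation "𝕊 " n:arg => (Metric.sphere (0 : EuclideanSpace ℝ (Fin (n + 1))) 1)

/-! ## Nonseparating surfaces -/

section NonseparatingSurface

variable {EM HM : Type*} [NormedAddCommGroup EM] [NormedSpace ℝ EM] [TopologicalSpace HM]
  (IM : ModelWithCorners ℝ EM HM) (M : Type*) [TopologicalSpace M] [ChartedSpace HM M]

/-- The manifold `M` (modelled on `IM`) **contains a nonseparating closed orientable surface of
genus `g`**: there are a compact connected smooth surface `S` without boundary (charts in `𝔼 2`),
orientable and with `rank_ℤ H₁(S; ℤ) = 2g` — i.e. a closed orientable surface of genus `g` — and a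
smooth injective immersion `F : S → M` (a smooth embedding, `S` being compact) whose image does
not separate `M`: the complement `M ∖ F(S)` is connected (in particular nonempty). This is the
"nonseparating oriented embedded surface in `M`" of genus `g` of Gabai (1987), Corollary 8.3. The
embedding condition is phrased exactly as in `Literature.Topology.FourManifolds.Knot.IsSpanningSurfaceOfGenus` (smooth,
injective, injective differential; for compact `S` this is a smooth embedding).
[cite: GabaiJDG1987, Cor. 8.3] -/
def HasNonseparatingSurfaceOfGenus (g : ℕ) : Prop :=
  ∃ (S : Type) (_ : TopologicalSpace S) (_ : T2Space S) (_ : SecondCountableTopology S)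
    (_ : CompactSpace S) (_ : ConnectedSpace S) (_ : ChartedSpace (𝔼 2) S)
    (_ : IsManifold (𝓡 2) ∞ S) (F : S → M),
    IsOrientable (𝓡 2) S ∧ Module.finrank ℤ (Literature.AlgebraicTopology.SingularHomology.singularHomology ℤ ℤ S 1) = 2 * g ∧
      ContMDiff (𝓡 2) IM ∞ F ∧ Injective F ∧ (∀ x, Injective (mfderiv (𝓡 2) IM F x)) ∧
      IsConnected (Set.range F)ᶜ

variable {IM M} in
/-- Unfolding lemma for `HasNonseparatingSurfaceOfGenus`: a witness is a closed connected
orientable surface `S` of genus `g` and a smooth injective immersion `F : S → M` with connected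
complement. [folklore] -/
theorem HasNonseparatingSurfaceOfGenus.intro {g : ℕ} (S : Type) [TopologicalSpace S] [T2Space S]
    [SecondCountableTopology S] [CompactSpace S] [ConnectedSpace S] [ChartedSpace (𝔼 2) S]
    [IsManifold (𝓡 2) ∞ S] (F : S → M) (ho : IsOrientable (𝓡 2) S)
    (hg : Module.finrank ℤ (Literature.AlgebraicTopology.SingularHomology.singularHomology ℤ ℤ S 1) = 2 * g) (hF : ContMDiff (𝓡 2) IM ∞ F)
    (hinj : Injective F) (himm : ∀ x, Injective (mfderiv (𝓡 2) IM F x))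
    (hc : IsConnected (Set.range F)ᶜ) : HasNonseparatingSurfaceOfGenus IM M g := by
  refine ⟨S, inferInstance, inferInstance, inferInstance, inferInstance, inferInstance,
    inferInstance, inferInstance, F, ?_⟩
  exact ⟨ho, hg, hF, hinj, himm, hc⟩

end NonseparatingSurface

/-- The circle minus a point is connected: `𝕊 1 ∖ {p}` is the source of the stereographic chart
`stereographic' 1 p`, a homeomorph onto `𝔼 1`. [folklore] -/
theorem isConnected_compl_singleton_sphereOne (p : 𝕊 1) : IsConnected ({p}ᶜ : Set (𝕊 1)) := by
  haveI : Fact (Module.finrank ℝ (EuclideanSpace ℝ (Fin (1 + 1))) = 1 + 1) :=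
    ⟨finrank_euclideanSpace_fin⟩
  have h1 : (stereographic' 1 p).source = {p}ᶜ := stereographic'_source p
  have h2 : (stereographic' 1 p).target = Set.univ := stereographic'_target p
  rw [← h1, ← (stereographic' 1 p).symm_image_target_eq_source, h2]
  exact isConnected_univ.image _ ((stereographic' 1 p).continuousOn_symm.mono (by simp))

/-- The `2`-sphere is connected (Mathlib `isConnected_sphere`, as `1 < 3 = rank ℝ³`). Stated as a
theorem, not an instance. [folklore] -/
theorem connectedSpace_sphereTwo : ConnectedSpace (𝕊 2) := by
  refine isConnected_iff_connectedSpace.mp (isConnected_sphere ?_ 0 zero_le_one)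
  rw [← Module.finrank_eq_rank, finrank_euclideanSpace_fin]
  exact Nat.one_lt_cast.mpr (by norm_num)

/-- **`S² × {p}` is a nonseparating sphere in `S² × S¹`** (the observation of Gabai's Remark 8.5):
the slice `x ↦ (x, p)` is a smooth injective immersion of the closed connected orientable surface
`𝕊 2` into the product manifold `↥(𝕊 2) × ↥(𝕊 1)`, its complement `𝕊 2 × (𝕊 1 ∖ {p})` is
connected (`𝕊 1 ∖ {p}` is, `Literature.Topology.FourManifolds.isConnected_compl_singleton_sphereOne`), and `𝕊 2` has genus
`0`, i.e. `rank_ℤ H₁(𝕊 2; ℤ) = 0` — GIVEN the classical named fact `hS : H₁(𝕊 2; ℤ) = 0`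
(`Literature.AlgebraicTopology.SingularHomology.isZero_singularHomology_sphere`, Hatcher (2002), Cor. 2.14). Orientability of `𝕊 2` is the
theorem `Literature.Topology.FourManifolds.isOrientable_sphere_holds`. [folklore] -/
theorem hasNonseparatingSurfaceOfGenus_zero_sphereTwo_prod
    (hS : Literature.AlgebraicTopology.SingularHomology.isZero_singularHomology_sphere ℤ ℤ) (p : 𝕊 1) :
    HasNonseparatingSurfaceOfGenus ((𝓡 2).prod (𝓡 1)) ((𝕊 2) × (𝕊 1)) 0 := by
  haveI : ConnectedSpace (𝕊 2) := connectedSpace_sphereTwo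
  refine HasNonseparatingSurfaceOfGenus.intro (𝕊 2) (fun x ↦ (x, p)) (isOrientable_sphere_holds 2)
    ?_ (contMDiff_id.prodMk contMDiff_const) (fun a b h ↦ congrArg Prod.fst h) (fun x ↦ ?_) ?_
  · haveI := ModuleCat.subsingleton_of_isZero (hS (n := 2) (k := 1) one_ne_zero (by decide))
    exact Module.finrank_zero_of_subsingleton
  · rw [mfderiv_prod_left]
    exact fun a b h ↦ congrArg Prod.fst h
  · have hr : (Set.range fun x : 𝕊 2 ↦ (x, p))ᶜ = (Set.univ : Set (𝕊 2)) ×ˢ ({p}ᶜ : Set (𝕊 1)) := by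
      ext ⟨x, q⟩
      simp [eq_comm]
    rw [hr]
    exact isConnected_univ.prod (isConnected_compl_singleton_sphereOne p)

namespace Knot

/-- **Gabai, *Foliations and the topology of 3-manifolds III*, J. Differential Geom. 26 (1987),
Corollary 8.3 (genus clause).** Printed statement (p. 525): "If `M` is obtained by performing
zero frame surgery on a knot in `S³`, then `M` is prime and
genus `k = min{genus S | S` is a nonseparating oriented embedded surface in `M}`." Here zero frame
surgery is Dehn surgery along the longitude of `k`, the curve on `∂N(k)` that is null-homologous
in the knot exterior (Definition 8.1, p. 524), i.e. framing `0`. **Vendored:** the half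
`genus k ≤ genus S` of the genus equality — for every knot `K`, every smooth manifold `M` that is a
`0`-surgery on `K` (`Literature.IsIntegralSurgery IM M K 0`, any model `IM`), and every nonseparating
closed connected orientable surface of genus `g` smoothly embedded in `M`
(`Literature.HasNonseparatingSurfaceOfGenus IM M g`), the knot `K` bounds a Seifert surface of genus at
most `g` (`∃ g' ≤ g, K.HasSeifertSurfaceOfGenus g'`; "genus `k`" is the least genus of a Seifert
surface, Seifert surfaces existing by Seifert's algorithm). **Not vendored:** the primeness of `M`
and the half `≥` (the minimum is attained: the capped-off minimal genus Seifert surface `Ŝ ⊆ M` of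
Corollary 8.2 is nonseparating of genus = genus `k`). Named fact (D-0014). The printed proof
(p. 525): "Apply the work of Novikov, Reeb, and Alexander to the conclusions of Corollary 8.2 to
conclude that `M` is prime. By Thurston [22] and Corollary 8.2 a genus `k` surface `Ŝ ⊂ M` is a
Thurston norm minimizing surface in `M`. Since `Ŝ` generates `H₂(M)`, the result follows." — here
Corollary 8.2 (p. 524) is the taut finite depth foliation on `M` with compact leaf `Ŝ` (the
capped-off minimal genus Seifert surface) obtained from Theorem 3.1 (sutured manifold
hierarchies), and [22] is W. P. Thurston, *A norm for the homology of three-manifolds*, Mem. Amer.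
Math. Soc. 59 (1986), no. 339; a foliation-free argument (Scharlemann) is Remarks 8.3½. None of
these ingredients is available in Mathlib or `Literature/`. [cite: GabaiJDG1987, Cor. 8.3] -/
def hasSeifertSurfaceOfGenus_le_of_isIntegralSurgery_zero : Prop :=
  ∀ (K : Knot) {EM HM : Type} [NormedAddCommGroup EM] [NormedSpace ℝ EM] [TopologicalSpace HM]
    (IM : ModelWithCorners ℝ EM HM) (M : Type u) [TopologicalSpace M] [ChartedSpace HM M]
    [IsManifold IM ∞ M] (_h : IsIntegralSurgery IM M K 0) (g : ℕ)
    (_hS : HasNonseparatingSurfaceOfGenus IM M g), ∃ g', g' ≤ g ∧ K.HasSeifertSurfaceOfGenus g'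

/-- **Zero surgery `S² × S¹` forces genus `0`** (Gabai (1987), Remark 8.5, from Corollary 8.3):
if the product manifold `↥(𝕊 2) × ↥(𝕊 1)` is a `0`-surgery on `K`, then `K` bounds a smoothly
embedded disc in `𝕊 3` (a Seifert surface of genus `0`, `Literature.Knot.HasSeifertSurfaceOfGenus K 0`).
Proof, as printed: `S² × {p}` is a nonseparating surface of genus `0` in `S² × S¹`
(`Literature.Topology.FourManifolds.hasNonseparatingSurfaceOfGenus_zero_sphereTwo_prod`), so Corollary 8.3
(`hasSeifertSurfaceOfGenus_le_of_isIntegralSurgery_zero`, at universe `0`) gives a Seifert surface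
of genus `≤ 0`. Hypotheses: the two named facts `h83` (Gabai, Cor. 8.3) and `hS : H₁(𝕊 2; ℤ) = 0`
(`Literature.AlgebraicTopology.SingularHomology.isZero_singularHomology_sphere`, Hatcher Cor. 2.14).
[cite: GabaiJDG1987, Cor. 8.3 and Remark 8.5] -/
theorem hasSeifertSurfaceOfGenus_zero_of_isIntegralSurgery_zero
    (h83 : hasSeifertSurfaceOfGenus_le_of_isIntegralSurgery_zero.{0})
    (hS : Literature.AlgebraicTopology.SingularHomology.isZero_singularHomology_sphere ℤ ℤ) (K : Knot)
    (h : IsIntegralSurgery ((𝓡 2).prod (𝓡 1)) ((𝕊 2) × (𝕊 1)) K 0) :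
    K.HasSeifertSurfaceOfGenus 0 := by
  have p : 𝕊 1 := ⟨EuclideanSpace.single 0 1, by simp⟩
  obtain ⟨g', hg', hK⟩ := h83 K ((𝓡 2).prod (𝓡 1)) ((𝕊 2) × (𝕊 1)) h 0
    (hasNonseparatingSurfaceOfGenus_zero_sphereTwo_prod hS p)
  obtain rfl := Nat.le_zero.mp hg'
  exact hK

/-- Under the same two named facts, a knot on which `0`-surgery gives `S² × S¹` has genus `0`
(`K.genus ≤ 0` by `Knot.genus_le_of_hasSeifertSurfaceOfGenus`). Gabai (1987), Cor. 8.3,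
Remark 8.5. [cite: GabaiJDG1987, Cor. 8.3 and Remark 8.5] -/
theorem genus_eq_zero_of_isIntegralSurgery_zero
    (h83 : hasSeifertSurfaceOfGenus_le_of_isIntegralSurgery_zero.{0})
    (hS : Literature.AlgebraicTopology.SingularHomology.isZero_singularHomology_sphere ℤ ℤ) (K : Knot)
    (h : IsIntegralSurgery ((𝓡 2).prod (𝓡 1)) ((𝕊 2) × (𝕊 1)) K 0) : K.genus = 0 :=
  Nat.eq_zero_of_le_zero
    (genus_le_of_hasSeifertSurfaceOfGenus
      (hasSeifertSurfaceOfGenus_zero_of_isIntegralSurgery_zero h83 hS K h))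

end Knot

section SPC4

variable [SphereEmbedding.SmoothnessFacts] in
/-- **Property R from its printed ingredients** (proved reduction of `spc4.S25`). Gabai's
Corollary 8.3 in the form `Knot.hasSeifertSurfaceOfGenus_le_of_isIntegralSurgery_zero` (genus
clause, half `≤`), the classical `H₁(𝕊 2; ℤ) = 0` (`isZero_singularHomology_sphere`, making
`S² × {p} ⊆ S² × S¹` a nonseparating surface of genus `0`), and "genus `0` iff unknot"
(`Knot.genus_eq_zero_iff_isUnknot`, Papakyriakopoulos 1957; Rolfsen §4.B) together give
`isUnknot_of_isIntegralSurgery_zero`: if `S² × S¹` is `0`-surgery on `K` then `K` is the unknot.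
This is exactly the deduction of Gabai's Remark 8.5 (p. 526).
[cite: GabaiJDG1987, Cor. 8.3 and Remark 8.5] -/
theorem isUnknot_of_isIntegralSurgery_zero_of_genus
    (h83 : Knot.hasSeifertSurfaceOfGenus_le_of_isIntegralSurgery_zero.{0})
    (hS : Literature.AlgebraicTopology.SingularHomology.isZero_singularHomology_sphere ℤ ℤ) (hD : Knot.genus_eq_zero_iff_isUnknot) :
    isUnknot_of_isIntegralSurgery_zero := by
  intro K h
  exact (hD K).1 (Knot.genus_eq_zero_of_isIntegralSurgery_zero h83 hS K h)

end SPC4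

/-! ## The reduction with `H₁(S²; ℤ) = 0` discharged

`Literature.AlgebraicTopology.SingularHomology.isZero_singularHomology_sphere` is proved in
`Literature.AlgebraicTopology.SingularHomology.ExcisionMayerVietorisProofs`
(`Literature.AlgebraicTopology.SingularHomology.isZero_singularHomology_sphere_holds`, Hatcher (2002), Cor. 2.14), so the hypothesis `hS`
above can be fed; what remains of Gabai's Remark 8.5 deduction are the two named facts `h83`
(Gabai (1987), Cor. 8.3, genus clause) and `hD` ("genus `0` iff unknot"). -/

/-- **`S² × {p}` is a nonseparating sphere in `S² × S¹`**, unconditionally: the closed connected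
orientable surface `𝕊 2`, of genus `0` (`rank_ℤ H₁(𝕊 2; ℤ) = 0` by
`Literature.AlgebraicTopology.SingularHomology.isZero_singularHomology_sphere_holds`, Hatcher Cor. 2.14), embedded as the slice
`x ↦ (x, p)`, has connected complement (Gabai (1987), Remark 8.5). [folklore] -/
theorem HasNonseparatingSurfaceOfGenus.sphereTwo_prod_sphereOne (p : 𝕊 1) :
    HasNonseparatingSurfaceOfGenus ((𝓡 2).prod (𝓡 1)) ((𝕊 2) × (𝕊 1)) 0 :=
  hasNonseparatingSurfaceOfGenus_zero_sphereTwo_prod (Literature.AlgebraicTopology.SingularHomology.isZero_singularHomology_sphere_holds ℤ ℤ) p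

namespace Knot

/-- **Zero surgery `S² × S¹` forces genus `0`**, from Gabai's Corollary 8.3 alone: if
`↥(𝕊 2) × ↥(𝕊 1)` is a `0`-surgery on `K`, then `K` bounds a smoothly embedded disc
(`K.HasSeifertSurfaceOfGenus 0`) — `S² × {p}` being a nonseparating surface of genus `0`
(`HasNonseparatingSurfaceOfGenus.sphereTwo_prod_sphereOne`). Gabai (1987), Cor. 8.3 and
Remark 8.5. [cite: GabaiJDG1987, Cor. 8.3 and Remark 8.5] -/
theorem hasSeifertSurfaceOfGenus_zero_of_isIntegralSurgery_zero_of_gabai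
    (h83 : hasSeifertSurfaceOfGenus_le_of_isIntegralSurgery_zero.{0}) (K : Knot)
    (h : IsIntegralSurgery ((𝓡 2).prod (𝓡 1)) ((𝕊 2) × (𝕊 1)) K 0) :
    K.HasSeifertSurfaceOfGenus 0 :=
  hasSeifertSurfaceOfGenus_zero_of_isIntegralSurgery_zero h83
    (Literature.AlgebraicTopology.SingularHomology.isZero_singularHomology_sphere_holds ℤ ℤ) K h

/-- From Gabai's Corollary 8.3 alone: a knot on which `0`-surgery gives `S² × S¹` has genus `0`.
Gabai (1987), Cor. 8.3 and Remark 8.5. [cite: GabaiJDG1987, Cor. 8.3 and Remark 8.5] -/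
theorem genus_eq_zero_of_isIntegralSurgery_zero_of_gabai
    (h83 : hasSeifertSurfaceOfGenus_le_of_isIntegralSurgery_zero.{0}) (K : Knot)
    (h : IsIntegralSurgery ((𝓡 2).prod (𝓡 1)) ((𝕊 2) × (𝕊 1)) K 0) : K.genus = 0 :=
  genus_eq_zero_of_isIntegralSurgery_zero h83 (Literature.AlgebraicTopology.SingularHomology.isZero_singularHomology_sphere_holds ℤ ℤ) K h

end Knot

section SPC4

variable [SphereEmbedding.SmoothnessFacts] in
/-- **Property R from Gabai's Corollary 8.3 and "genus `0` iff unknot"** (proved reduction of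
`spc4.S25` to two named facts): `Knot.hasSeifertSurfaceOfGenus_le_of_isIntegralSurgery_zero`
(Gabai (1987), Cor. 8.3, genus clause) and `Knot.genus_eq_zero_iff_isUnknot`
(Papakyriakopoulos 1957; Rolfsen §4.B) give `isUnknot_of_isIntegralSurgery_zero`; the third
ingredient of `isUnknot_of_isIntegralSurgery_zero_of_genus`, `H₁(𝕊 2; ℤ) = 0`, is the theorem
`isZero_singularHomology_sphere_holds`. This is the deduction of Gabai's Remark 8.5 (p. 526).
[cite: GabaiJDG1987, Cor. 8.3 and Remark 8.5] -/
theorem isUnknot_of_isIntegralSurgery_zero_of_gabai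
    (h83 : Knot.hasSeifertSurfaceOfGenus_le_of_isIntegralSurgery_zero.{0})
    (hD : Knot.genus_eq_zero_iff_isUnknot) : isUnknot_of_isIntegralSurgery_zero :=
  isUnknot_of_isIntegralSurgery_zero_of_genus h83 (Literature.AlgebraicTopology.SingularHomology.isZero_singularHomology_sphere_holds ℤ ℤ) hD

end SPC4

end Literature.Topology.FourManifolds
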